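import Mathlib
import HarnessLib
import Literature.Analysis.Complex.CrossTheoremNStrips
import Literature.Analysis.Complex.OsgoodSeparate

/-!
# Stub `stub_crossLemma` of line `self-energy-pick-inversion` (crux
# `PrecisionLaplacian.DirectCorrelationStableTail`, stmt-CriticalPhenomena-4799): the 3-fold
# Bernstein–Siciak CROSS LEMMA for intervals `[-1,1]` in discs `B(0,2)`

**Statement** (registered text, = `CrossLemma` of the lead's skeleton and of the sibling line
nine-frame-cross-analyticity).  There is `ρ > 0` such that every `f : ℂ³ → ℂ` which is separately
holomorphic on the three-armed cross `X = ⋃ⱼ {w : w_i = a_i ∈ [-1,1] (i ≠ j), |w_j| < 2}` (each arm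
slice `z ↦ f (update a j z)` holomorphic on `B(0,2)`) and bounded by `M` on `X` agrees, on the part of
`X` inside the polydisc `{‖w_i‖ < ρ}`, with ONE function `g` analytic on that polydisc and bounded by
the same `M`.

**Proof.**  GLUE from the tree's local cross theorem in `N` variables,
`Literature.Analysis.Complex.exists_holomorphic_extension_of_separately_local_fintype` (`ι = Fin 3`,
`ℓ = 1`, giving a radius `r`; we take `ρ = min r 1`): the real trace `P x = f x` (`x ∈ (-1,1)³`) is
bounded by `M` (a real point lies on every arm) and its one-variable slices are traces of the arm
slices, holomorphic and bounded by `M` on `B(0,1) ⊆ B(0,2)`; the theorem yields `G` holomorphic and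
bounded by `M` on the `r`-polydisc with `G x = f x` for real `x ∈ (-r,r)³`.  Holomorphic on an open
subset of `ℂ³` ⇒ analytic (Osgood, `Literature.Analysis.Complex.SCV.analyticOnNhd_of_differentiableOn`).
Agreement on an arm inside the `ρ`-polydisc: `ζ ↦ G (update a j ζ)` and `ζ ↦ f (update a j ζ)` are
holomorphic on the disc `B(0,ρ)` and agree for real `ζ ∈ (-ρ,ρ)` (there `update a j ζ` is a real point
of the `r`-cube), hence on the whole disc by the one-variable identity theorem (the reals accumulate
at `0`, `Literature.Analysis.Complex.frequently_nhdsNE_zero_of_forall_ofReal`).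

Pure theorem file, no definitions, no `sorry`.  References: S. N. Bernstein, Mém. Acad. Roy. Belgique
(1912); J. Siciak, Ann. Polon. Math. 22 (1969); M. Jarnicki, P. Pflug, *Separately Analytic
Functions*, EMS Tracts 16 (2011), Ch. 5 [JarnickiPflug2011].
-/

noncomputable section

namespace Summit.CriticalPhenomena.Ising3DConformalLimit.Cruxes.DirectCorrelationStableTail.SelfEnergyPickInversion

open Filter Topology Complex Metric Set
open Literature.Analysis.Complex

/-! ### Casting and the polydisc -/

/-- Casting `ℝ → ℂ` coordinatewise commutes with `Function.update`. [folklore] -/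
theorem crossLemma_ofReal_update (y : Fin 3 → ℝ) (k : Fin 3) (t : ℝ) :
    Function.update (fun i => ((y i : ℝ) : ℂ)) k ((t : ℝ) : ℂ) =
      fun i => ((Function.update y k t i : ℝ) : ℂ) := by
  funext i
  by_cases h : i = k
  · subst h
    simp
  · simp [Function.update_of_ne h]

/-- The open polydisc `{‖z_i‖ < ρ}` of `ℂ³` is open. [folklore] -/
theorem crossLemma_isOpen_polydisc (ρ : ℝ) : IsOpen {z : Fin 3 → ℂ | ∀ i, ‖z i‖ < ρ} := by
  rw [Set.setOf_forall]
  exact isOpen_iInter_of_finite fun k => isOpen_lt (continuous_apply k).norm continuous_const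

/-- The arm slice `ζ ↦ update c j ζ` is complex differentiable. [folklore] -/
theorem crossLemma_differentiable_update (c : Fin 3 → ℂ) (j : Fin 3) :
    Differentiable ℂ (Function.update c j) :=
  fun ζ => (hasFDerivAt_update (𝕜 := ℂ) c ζ).differentiableAt

/-- **Identity theorem on a disc from the real axis**: two functions holomorphic on `B(0,ρ) ⊆ ℂ`
which agree at all real points of the disc agree on the disc. [folklore] -/
theorem crossLemma_eqOn_ball_of_forall_ofReal {φ ψ : ℂ → ℂ} {ρ : ℝ} (hρ : 0 < ρ)
    (hφ : DifferentiableOn ℂ φ (ball (0 : ℂ) ρ)) (hψ : DifferentiableOn ℂ ψ (ball (0 : ℂ) ρ))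
    (h : ∀ t : ℝ, |t| < ρ → φ t = ψ t) : EqOn φ ψ (ball (0 : ℂ) ρ) := by
  have hfreq : ∃ᶠ ζ in 𝓝[≠] (0 : ℂ), φ ζ = ψ ζ := by
    have h1 : ∃ᶠ ζ in 𝓝[≠] (0 : ℂ), ‖ζ‖ < ρ → φ ζ = ψ ζ :=
      frequently_nhdsNE_zero_of_forall_ofReal (P := fun ζ : ℂ => ‖ζ‖ < ρ → φ ζ = ψ ζ) fun t ht =>
        h t (by simpa [Complex.norm_real, Real.norm_eq_abs] using ht)
    have h2 : ∀ᶠ ζ in 𝓝[≠] (0 : ℂ), ‖ζ‖ < ρ := by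
      have : ball (0 : ℂ) ρ ∈ 𝓝[≠] (0 : ℂ) := mem_nhdsWithin_of_mem_nhds (ball_mem_nhds _ hρ)
      filter_upwards [this] with ζ hζ using mem_ball_zero_iff.mp hζ
    exact h1.mp (h2.mono fun ζ hζ hP => hP hζ)
  exact (hφ.analyticOnNhd isOpen_ball).eqOn_of_preconnected_of_frequently_eq
    (hψ.analyticOnNhd isOpen_ball) (convex_ball (0 : ℂ) ρ).isPreconnected (mem_ball_self hρ) hfreq

/-! ### The cross lemma -/

/-- **The 3-fold cross lemma for intervals in discs** (Bernstein 1912; Siciak, Ann. Polon. Math. 22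
(1969); Jarnicki–Pflug 2011, Ch. 5), registered stub `stub_crossLemma` = `CrossLemma` of the lead's
skeleton: there is `ρ > 0` such that every function of three complex variables separately holomorphic on
the cross `⋃ⱼ [-1,1] × ⋯ × B(0,2)_j × ⋯ × [-1,1]` and bounded by `M` there agrees, on the cross inside the
polydisc `{‖zᵢ‖ < ρ}`, with a function analytic on that polydisc and bounded by `M`.  Glue from the
tree's local cross theorem `exists_holomorphic_extension_of_separately_local_fintype` (`ι = Fin 3`,
`ℓ = 1`), Osgood's lemma and the one-variable identity theorem from the real axis.
[cite: JarnickiPflug2011, Ch. 5 (classical cross theorem with estimate)] -/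
theorem stub_crossLemma :
    ∃ ρ : ℝ, 0 < ρ ∧ ∀ (f : (Fin 3 → ℂ) → ℂ) (M : ℝ), (∀ (j : Fin 3) (a : Fin 3 → ℝ), (∀ i, |a i| ≤ 1) →
      DifferentiableOn ℂ (fun z : ℂ => f (Function.update (fun i => ((a i : ℝ) : ℂ)) j z)) (Metric.ball (0
      : ℂ) 2)) → (∀ (j : Fin 3) (a : Fin 3 → ℝ) (z : ℂ), (∀ i, |a i| ≤ 1) → ‖z‖ < 2 →
      ‖f (Function.update (fun i => ((a i : ℝ) : ℂ)) j z)‖ ≤ M) → ∃ g : (Fin 3 → ℂ) →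
      ℂ, AnalyticOnNhd ℂ g {z | ∀ i, ‖z i‖ < ρ} ∧ (∀ z : Fin 3 → ℂ, (∀ i, ‖z i‖ < ρ) → ‖g z‖ ≤ M) ∧
      ∀ (j : Fin 3) (a : Fin 3 → ℝ) (z : ℂ), (∀ i, |a i| ≤ 1) → ‖z‖ < 2 →
      (∀ i, ‖Function.update (fun i => ((a i : ℝ) : ℂ)) j z i‖ < ρ) →
      g (Function.update (fun i => ((a i : ℝ) : ℂ)) j z) = f (Function.update (fun i => ((a i : ℝ) : ℂ)) j
      z) := by
  obtain ⟨r, hr, hthm⟩ :=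
    exists_holomorphic_extension_of_separately_local_fintype (ι := Fin 3) 1 one_pos
  refine ⟨min r 1, lt_min hr one_pos, fun f M hdiff hbd => ?_⟩
  have hρr : min r 1 ≤ r := min_le_left _ _
  have hρ1 : min r 1 ≤ 1 := min_le_right _ _
  -- the real trace of `f` and its cross data on the open unit cube
  obtain ⟨P, hPdef⟩ : ∃ P : (Fin 3 → ℝ) → ℂ, P = fun x => f (fun i => ((x i : ℝ) : ℂ)) := ⟨_, rfl⟩
  have hP : ∀ x : Fin 3 → ℝ, (∀ k, |x k| < 1) → ‖P x‖ ≤ M := by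
    intro x hx
    have hx0 : ‖((x 0 : ℝ) : ℂ)‖ < 2 := by
      rw [Complex.norm_real, Real.norm_eq_abs]; linarith [hx 0]
    have h := hbd 0 x ((x 0 : ℝ) : ℂ) (fun i => (hx i).le) hx0
    have hupd : Function.update (fun i => ((x i : ℝ) : ℂ)) 0 ((x 0 : ℝ) : ℂ) =
        fun i => ((x i : ℝ) : ℂ) := Function.update_eq_self (0 : Fin 3) (fun i => ((x i : ℝ) : ℂ))
    rw [hupd] at h
    rw [hPdef]
    exact h
  have h1 : ∀ (k : Fin 3) (y : Fin 3 → ℝ), (∀ j, |y j| < 1) → ∃ g : ℂ → ℂ,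
      DifferentiableOn ℂ g (ball (0 : ℂ) 1) ∧ (∀ w ∈ ball (0 : ℂ) 1, ‖g w‖ ≤ M) ∧
      ∀ t : ℝ, |t| < 1 → g t = P (Function.update y k t) := by
    intro k y hy
    refine ⟨fun ζ => f (Function.update (fun i => ((y i : ℝ) : ℂ)) k ζ),
      (hdiff k y fun i => (hy i).le).mono (ball_subset_ball (by norm_num)), fun w hw => ?_,
      fun t _ => ?_⟩
    · exact hbd k y w (fun i => (hy i).le) (by have := mem_ball_zero_iff.mp hw; linarith)
    · show f (Function.update (fun i => ((y i : ℝ) : ℂ)) k ((t : ℝ) : ℂ)) = P (Function.update y k t)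
      rw [crossLemma_ofReal_update, hPdef]
  obtain ⟨G, hGd, hGb, hGr⟩ := hthm M P hP h1
  refine ⟨G, ?_, fun z hz => hGb z fun k => (hz k).trans_le hρr, ?_⟩
  · -- analyticity on the `ρ`-polydisc (Osgood)
    have hsub : {z : Fin 3 → ℂ | ∀ i, ‖z i‖ < min r 1} ⊆ {z : Fin 3 → ℂ | ∀ k, ‖z k‖ < r} :=
      fun z hz k => (hz k).trans_le hρr
    exact (SCV.analyticOnNhd_of_differentiableOn hGd (crossLemma_isOpen_polydisc r)).mono hsub
  · -- agreement on the arms inside the `ρ`-polydisc (identity theorem from the real axis)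
    intro j a z ha hz hw
    have haρ : ∀ i, i ≠ j → |a i| < min r 1 := by
      intro i hij
      have h := hw i
      rwa [Function.update_of_ne hij, Complex.norm_real, Real.norm_eq_abs] at h
    have hzρ : ‖z‖ < min r 1 := by
      have h := hw j
      rwa [Function.update_self] at h
    -- the arm slice maps the `ρ`-disc into the `r`-polydisc
    have hmaps : MapsTo (Function.update (fun i => ((a i : ℝ) : ℂ)) j) (ball (0 : ℂ) (min r 1))
        {w : Fin 3 → ℂ | ∀ k, ‖w k‖ < r} := by
      intro ζ hζ k
      by_cases hk : k = j
      · subst hk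
        rw [Function.update_self]
        exact (mem_ball_zero_iff.mp hζ).trans_le hρr
      · rw [Function.update_of_ne hk, Complex.norm_real, Real.norm_eq_abs]
        exact (haρ k hk).trans_le hρr
    have hφ : DifferentiableOn ℂ (fun ζ => G (Function.update (fun i => ((a i : ℝ) : ℂ)) j ζ))
        (ball (0 : ℂ) (min r 1)) :=
      hGd.comp (crossLemma_differentiable_update _ j).differentiableOn hmaps
    have hψ : DifferentiableOn ℂ (fun ζ => f (Function.update (fun i => ((a i : ℝ) : ℂ)) j ζ))
        (ball (0 : ℂ) (min r 1)) :=
      (hdiff j a ha).mono (ball_subset_ball (by linarith))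
    have hreal : ∀ t : ℝ, |t| < min r 1 →
        G (Function.update (fun i => ((a i : ℝ) : ℂ)) j t) =
          f (Function.update (fun i => ((a i : ℝ) : ℂ)) j t) := by
      intro t ht
      have hcube : ∀ k, |Function.update a j t k| < r := by
        intro k
        by_cases hk : k = j
        · subst hk
          rw [Function.update_self]
          exact ht.trans_le hρr
        · rw [Function.update_of_ne hk]
          exact (haρ k hk).trans_le hρr
      rw [crossLemma_ofReal_update, hGr _ hcube, hPdef]
    exact crossLemma_eqOn_ball_of_forall_ofReal (lt_min hr one_pos) hφ hψ hreal
      (mem_ball_zero_iff.mpr hzρ)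

end Summit.CriticalPhenomena.Ising3DConformalLimit.Cruxes.DirectCorrelationStableTail.SelfEnergyPickInversion

end
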